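import Mathlib
import Literature.Computability.AlgebraicComplexity.GenericTorusGrading
import Literature.Computability.AlgebraicComplexity.LRPencilOfMatrix

/-!
# `ConfusionCovering` (crux dir `OrbitDimensionBound`, stmt-ValiantsHypothesis-16133, route FreeSubtorus):
# eigenspace-adapted bases — the GRADED BIPARTITE FORM of an affine matrix carrying an exact torus lift

Tool file for the proof of the rung `ConfusionCovering` (`Cruxes/OrbitDimensionBound/Lines/ConfusionLadder.lean`;
the line `confusion_covering` and its stub `stub_pathWeights`).

* `exists_adapted_basis`: for an endomorphism `G` of `ℂ^m`, a basis of `ℂ^m` indexed by `Fin m` consisting of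
  generalised eigenvectors, with its weight function `wt : Fin m → ℂ`: coordinates of a vector of `E_G(μ)` vanish
  at indices of weight `≠ μ`, and the number of indices of weight `μ` is `dim E_G(μ)`.
* `exists_gradedForm`: if `g A₀ = A₀ h` and `g A_v = w_v A_v h` for the constant part `A₀` and the coefficient matrices
  `A_v` of an affine matrix `A` over `MvPolynomial ι ℂ`, then for invertible `P, Q` (change to bases adapted to
  `g` on rows, weights `β`, and to `h` on columns, weights `α`) the matrix `P A Q` is GRADED: a non-zero constant
  entry at `(i, j)` forces `β i = α j`, a non-zero `x_v`-coefficient forces `β i = w_v · α j`; and the weight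
  multiplicities are the generalised-eigenspace dimensions.  (LR17 §6 decomposes by weights of a lifted torus;
  here ONE pair `(g, h)` and its generalised eigenspaces suffice.)
* `finrank_maxGen_le_of_ker_le`, `finrank_maxGen_le_add_of_ker_le`: if moreover `ker A₀ ⊆ E_h(γ₀)`, then
  `dim E_h(μ) ≤ dim E_g(μ)` for `μ ≠ γ₀` and `dim E_h(γ₀) ≤ dim E_g(γ₀) + dim ker A₀` (`A₀` restricted to `E_h(μ)`
  lands in `E_g(μ)` and is injective off `γ₀`).

[cite: LandsbergRessayre2017, §6]
-/

open Matrix MvPolynomial Finset Module.End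
open Literature.Computability.AlgebraicComplexity LRPencil

-- the mandated summit-side namespace repeats a component by design (single-problem summit)
set_option linter.dupNamespace false

namespace Summit.ValiantsHypothesis.ValiantsHypothesis.Theorems.FreeSubtorusConfusionCovering

noncomputable section

/-! ### One endomorphism: a basis of generalised eigenvectors indexed by `Fin m` -/

/-- **Adapted basis.**  For an endomorphism `G` of `ℂ^m` there is a basis `b` of `ℂ^m` indexed by `Fin m` and a
weight function `wt` with `b i ∈ E_G(wt i)`, such that the `i`-th coordinate of any `x ∈ E_G(μ)` vanishes unless
`wt i = μ`, and `#{i | wt i = μ} = dim E_G(μ)` for every `μ`.  (Collected bases of the internal direct sum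
`ℂ^m = ⊕_μ E_G(μ)`, `ℂ` algebraically closed.) [folklore] -/
theorem exists_adapted_basis (m : ℕ) (G : Module.End ℂ (Fin m → ℂ)) :
    ∃ (b : Module.Basis (Fin m) ℂ (Fin m → ℂ)) (wt : Fin m → ℂ),
      (∀ i, b i ∈ G.maxGenEigenspace (wt i)) ∧
      (∀ (x : Fin m → ℂ) (μ : ℂ) (i : Fin m), x ∈ G.maxGenEigenspace μ → wt i ≠ μ → b.repr x i = 0) ∧
      (∀ μ, (univ.filter fun i => wt i = μ).card = Module.finrank ℂ (G.maxGenEigenspace μ)) := by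
  classical
  set E : ℂ → Submodule ℂ (Fin m → ℂ) := fun μ => G.maxGenEigenspace μ with hE
  have hint : DirectSum.IsInternal E :=
    DirectSum.isInternal_submodule_of_iSupIndep_of_iSup_eq_top G.independent_maxGenEigenspace
      (Module.End.iSup_maxGenEigenspace_eq_top G)
  let d : ℂ → ℕ := fun μ => Module.finrank ℂ (E μ)
  let v : (μ : ℂ) → Module.Basis (Fin (d μ)) ℂ (E μ) := fun μ => Module.finBasis ℂ (E μ)
  let cb := hint.collectedBasis v
  letI : Fintype (Σ μ : ℂ, Fin (d μ)) := FiniteDimensional.fintypeBasisIndex cb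
  have hcard : Fintype.card (Σ μ : ℂ, Fin (d μ)) = m := by
    rw [← Module.finrank_eq_card_basis cb, Module.finrank_fin_fun]
  let e : (Σ μ : ℂ, Fin (d μ)) ≃ Fin m := Fintype.equivFinOfCardEq hcard
  refine ⟨cb.reindex e, fun i => (e.symm i).1, fun i => ?_, fun x μ i hx hne => ?_, fun μ => ?_⟩
  · rw [Module.Basis.reindex_apply]
    exact hint.collectedBasis_mem v (e.symm i)
  · rw [Module.Basis.repr_reindex_apply]
    have : ((hint.collectedBasis v).repr x) ⟨(e.symm i).1, (e.symm i).2⟩ = 0 :=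
      hint.collectedBasis_repr_of_mem_ne v (i := μ) (j := (e.symm i).1) (Ne.symm hne) hx
    simpa using this
  · have h1 : (univ.filter fun i : Fin m => (e.symm i).1 = μ) =
        (univ.filter fun a : (Σ μ : ℂ, Fin (d μ)) => a.1 = μ).map e.toEmbedding := by
      ext i
      simp only [mem_filter, mem_univ, true_and, mem_map_equiv]
    have h2 : (univ.filter fun a : (Σ μ : ℂ, Fin (d μ)) => a.1 = μ) =
        (univ : Finset (Fin (d μ))).map ⟨Sigma.mk μ, sigma_mk_injective⟩ := by
      ext a
      simp only [mem_filter, mem_univ, true_and, mem_map, Function.Embedding.coeFn_mk]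
      constructor
      · obtain ⟨μ', k⟩ := a
        rintro (rfl : μ' = μ)
        exact ⟨k, rfl⟩
      · rintro ⟨k, rfl⟩
        rfl
    rw [h1, card_map, h2, card_map, card_univ, Fintype.card_fin]

/-! ### Two endomorphisms: the graded bipartite form -/

/-- Change of basis on both sides: `(b_R.toMatrix std) * M * (std.toMatrix b_C)` is the matrix of `toLin' M` in the
bases `b_C` (source) and `b_R` (target). [folklore] -/
theorem toMatrix_mul_mul_toMatrix_apply {m : ℕ} (bR bC : Module.Basis (Fin m) ℂ (Fin m → ℂ))
    (M : Matrix (Fin m) (Fin m) ℂ) (i j : Fin m) :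
    (bR.toMatrix (Pi.basisFun ℂ (Fin m)) * M * (Pi.basisFun ℂ (Fin m)).toMatrix bC) i j =
      bR.repr (Matrix.toLin' M (bC j)) i := by
  classical
  have h := basis_toMatrix_mul_linearMap_toMatrix_mul_basis_toMatrix bC (Pi.basisFun ℂ (Fin m)) bR
    (Pi.basisFun ℂ (Fin m)) (Matrix.toLin' M)
  rw [LinearMap.toMatrix_eq_toMatrix', LinearMap.toMatrix'_toLin'] at h
  rw [h, LinearMap.toMatrix_apply]

/-- If `toLin' g ∘ toLin' M = c • (toLin' M ∘ toLin' h)` (as matrices: `g M = c • (M h)`), then in bases adapted to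
`h` (columns, weights `α`) and `g` (rows, weights `β`) the `(i, j)` entry of `M` vanishes unless `β i = c · α j`.
[cite: LandsbergRessayre2017, §6] -/
theorem adapted_entry_eq_zero {m : ℕ} {g h M : Matrix (Fin m) (Fin m) ℂ} {c : ℂ}
    (hM : g * M = c • (M * h))
    {bR bC : Module.Basis (Fin m) ℂ (Fin m → ℂ)} {α β : Fin m → ℂ}
    (hbC : ∀ j, bC j ∈ Module.End.maxGenEigenspace (Matrix.toLin' h) (α j))
    (hbR : ∀ (x : Fin m → ℂ) (μ : ℂ) (i : Fin m), x ∈ Module.End.maxGenEigenspace (Matrix.toLin' g) μ → β i ≠ μ →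
      bR.repr x i = 0)
    (i j : Fin m) (hne : β i ≠ c * α j) :
    (bR.toMatrix (Pi.basisFun ℂ (Fin m)) * M * (Pi.basisFun ℂ (Fin m)).toMatrix bC) i j = 0 := by
  rw [toMatrix_mul_mul_toMatrix_apply]
  have hcomp : Matrix.toLin' g ∘ₗ Matrix.toLin' M = c • (Matrix.toLin' M ∘ₗ Matrix.toLin' h) := by
    rw [← Matrix.toLin'_mul, hM, map_smul, Matrix.toLin'_mul]
  have hmem := mapsTo_maxGenEigenspace_of_comp_eq_smul (Matrix.toLin' g) (Matrix.toLin' h) (Matrix.toLin' M) c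
    hcomp (α j) (hbC j)
  exact hbR _ _ i hmem hne

/-- **Graded bipartite form.**  Let `A` be a matrix over `MvPolynomial ι ℂ` and `g, h ∈ M_m(ℂ)` with
`g A₀ = A₀ h` (`A₀ = constPart A`) and `g A_v = w_v · A_v h` for every coefficient matrix `A_v = coeffMat A v`.  Then
there are invertible `P, Q` and weights `α, β : Fin m → ℂ` (generalised eigenvalues of `h`, resp. `g`) such that
`A' = P A Q` satisfies: `constPart A' i j ≠ 0 ⇒ β i = α j`, `coeffMat A' v i j ≠ 0 ⇒ β i = w v · α j`, and
`#{i | β i = μ} = dim E_g(μ)`, `#{j | α j = μ} = dim E_h(μ)` for every `μ`.  (Bases adapted to the generalised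
eigenspaces; LR17 §6 uses the weight spaces of a lifted torus instead.) [cite: LandsbergRessayre2017, §6] -/
theorem exists_gradedForm {m : ℕ} {ι : Type*} [Fintype ι] [DecidableEq ι]
    (A : Matrix (Fin m) (Fin m) (MvPolynomial ι ℂ)) (w : ι → ℂ) (g h : Matrix (Fin m) (Fin m) ℂ)
    (h0 : g * constPart A = constPart A * h)
    (hv : ∀ v, g * coeffMat A v = w v • (coeffMat A v * h)) :
    ∃ (P Q : GL (Fin m) ℂ) (α β : Fin m → ℂ),
      (∀ i j, constPart ((P : Matrix (Fin m) (Fin m) ℂ).map C * A * (Q : Matrix (Fin m) (Fin m) ℂ).map C) i j ≠ 0 →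
        β i = α j) ∧
      (∀ v i j, coeffMat ((P : Matrix (Fin m) (Fin m) ℂ).map C * A * (Q : Matrix (Fin m) (Fin m) ℂ).map C) v i j ≠ 0 →
        β i = w v * α j) ∧
      (∀ μ, (univ.filter fun i => β i = μ).card = Module.finrank ℂ (Module.End.maxGenEigenspace (Matrix.toLin' g) μ)) ∧
      (∀ μ, (univ.filter fun j => α j = μ).card = Module.finrank ℂ (Module.End.maxGenEigenspace (Matrix.toLin' h) μ)) := by
  classical
  obtain ⟨bR, β, hbRmem, hbR, hβ⟩ := exists_adapted_basis m (Matrix.toLin' g)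
  obtain ⟨bC, α, hbCmem, hbC, hα⟩ := exists_adapted_basis m (Matrix.toLin' h)
  set std := Pi.basisFun ℂ (Fin m) with hstd
  set P : Matrix (Fin m) (Fin m) ℂ := bR.toMatrix std with hP
  set Q : Matrix (Fin m) (Fin m) ℂ := std.toMatrix bC with hQ
  have hPdet : P.det ≠ 0 := by
    have h1 : P * std.toMatrix bR = 1 := Module.Basis.toMatrix_mul_toMatrix_flip bR std
    have h2 := congrArg Matrix.det h1
    rw [Matrix.det_mul, Matrix.det_one] at h2
    exact left_ne_zero_of_mul_eq_one h2
  have hQdet : Q.det ≠ 0 := by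
    have h1 : Q * bC.toMatrix std = 1 := Module.Basis.toMatrix_mul_toMatrix_flip std bC
    have h2 := congrArg Matrix.det h1
    rw [Matrix.det_mul, Matrix.det_one] at h2
    exact left_ne_zero_of_mul_eq_one h2
  refine ⟨Matrix.GeneralLinearGroup.mkOfDetNeZero P hPdet, Matrix.GeneralLinearGroup.mkOfDetNeZero Q hQdet, α, β,
    ?_, ?_, hβ, hα⟩
  · intro i j hij
    rw [Matrix.GeneralLinearGroup.val_mkOfDetNeZero, Matrix.GeneralLinearGroup.val_mkOfDetNeZero,
      constPart_mul, constPart_mul, constPart_map_C, constPart_map_C] at hij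
    by_contra hne
    have h0' : g * constPart A = (1 : ℂ) • (constPart A * h) := by rw [one_smul]; exact h0
    exact hij (adapted_entry_eq_zero h0' hbCmem hbR i j (by rwa [one_mul]))
  · intro v i j hij
    rw [Matrix.GeneralLinearGroup.val_mkOfDetNeZero, Matrix.GeneralLinearGroup.val_mkOfDetNeZero,
      coeffMat_C_mul_mul_C] at hij
    by_contra hne
    exact hij (adapted_entry_eq_zero (hv v) hbCmem hbR i j hne)

/-! ### Multiplicities: `A₀` is injective on `E_h(μ)` off the kernel weight -/

/-- If `G ∘ Λ = Λ ∘ H` then `Λ` maps `E_H(μ)` into `E_G(μ)`. [folklore] -/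
theorem mapsTo_maxGen_of_comp_eq {V W : Type*} [AddCommGroup V] [Module ℂ V] [AddCommGroup W] [Module ℂ W]
    (G : Module.End ℂ W) (H : Module.End ℂ V) (Λ : V →ₗ[ℂ] W) (hint : G ∘ₗ Λ = Λ ∘ₗ H) (μ : ℂ) :
    ∀ x ∈ H.maxGenEigenspace μ, Λ x ∈ G.maxGenEigenspace μ := by
  intro x hx
  have h1 : G ∘ₗ Λ = (1 : ℂ) • (Λ ∘ₗ H) := by rw [one_smul]; exact hint
  have := mapsTo_maxGenEigenspace_of_comp_eq_smul G H Λ 1 h1 μ hx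
  rwa [one_mul] at this

/-- **Multiplicity inequality off the kernel weight.**  If `G ∘ Λ = Λ ∘ H` and `ker Λ ⊆ E_H(γ₀)`, then for
`μ ≠ γ₀` the restriction `E_H(μ) → E_G(μ)` of `Λ` is injective, so `dim E_H(μ) ≤ dim E_G(μ)`. [folklore] -/
theorem finrank_maxGen_le_of_ker_le {V W : Type*} [AddCommGroup V] [Module ℂ V] [AddCommGroup W] [Module ℂ W]
    [FiniteDimensional ℂ W] (G : Module.End ℂ W) (H : Module.End ℂ V) (Λ : V →ₗ[ℂ] W)
    (hint : G ∘ₗ Λ = Λ ∘ₗ H) {γ₀ μ : ℂ} (hker : LinearMap.ker Λ ≤ H.maxGenEigenspace γ₀) (hμ : μ ≠ γ₀) :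
    Module.finrank ℂ (H.maxGenEigenspace μ) ≤ Module.finrank ℂ (G.maxGenEigenspace μ) := by
  set φ := Λ.restrict (mapsTo_maxGen_of_comp_eq G H Λ hint μ) with hφ
  refine LinearMap.finrank_le_finrank_of_injective (f := φ) ?_
  rw [← LinearMap.ker_eq_bot, eq_bot_iff]
  intro x hx
  rw [LinearMap.mem_ker, hφ, LinearMap.restrict_apply, Subtype.ext_iff, Submodule.coe_zero] at hx
  have h1 : (x : V) ∈ H.maxGenEigenspace γ₀ := hker (LinearMap.mem_ker.2 hx)
  have hdisj : Disjoint (H.maxGenEigenspace μ) (H.maxGenEigenspace γ₀) :=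
    H.independent_maxGenEigenspace.pairwiseDisjoint hμ
  rw [Submodule.mem_bot, Subtype.ext_iff, Submodule.coe_zero]
  exact (Submodule.disjoint_def.1 hdisj) _ x.2 h1

/-- **Multiplicity inequality at the kernel weight.**  If `G ∘ Λ = Λ ∘ H` then
`dim E_H(γ₀) ≤ dim E_G(γ₀) + dim ker Λ` (rank–nullity for the restriction of `Λ` to `E_H(γ₀)`, whose kernel embeds
in `ker Λ`). [folklore] -/
theorem finrank_maxGen_le_add {V W : Type*} [AddCommGroup V] [Module ℂ V] [AddCommGroup W] [Module ℂ W]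
    [FiniteDimensional ℂ V] [FiniteDimensional ℂ W] (G : Module.End ℂ W) (H : Module.End ℂ V) (Λ : V →ₗ[ℂ] W)
    (hint : G ∘ₗ Λ = Λ ∘ₗ H) (γ₀ : ℂ) :
    Module.finrank ℂ (H.maxGenEigenspace γ₀) ≤
      Module.finrank ℂ (G.maxGenEigenspace γ₀) + Module.finrank ℂ (LinearMap.ker Λ) := by
  set φ := Λ.restrict (mapsTo_maxGen_of_comp_eq G H Λ hint γ₀) with hφ
  have h1 := LinearMap.finrank_range_add_finrank_ker φ
  have h2 : Module.finrank ℂ (LinearMap.range φ) ≤ Module.finrank ℂ (G.maxGenEigenspace γ₀) :=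
    Submodule.finrank_le _
  have h3 : Module.finrank ℂ (LinearMap.ker φ) ≤ Module.finrank ℂ (LinearMap.ker Λ) := by
    rw [← Submodule.finrank_map_subtype_eq (H.maxGenEigenspace γ₀) (LinearMap.ker φ)]
    apply Submodule.finrank_mono
    intro x hx
    rw [Submodule.mem_map] at hx
    obtain ⟨y, hy, rfl⟩ := hx
    rw [LinearMap.mem_ker, hφ, LinearMap.restrict_apply, Subtype.ext_iff, Submodule.coe_zero] at hy
    exact LinearMap.mem_ker.2 hy
  omega

end

end Summit.ValiantsHypothesis.ValiantsHypothesis.Theorems.FreeSubtorusConfusionCovering
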